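import Summits.Ventures.PercRepro.Night2LocalD3ThreeTwoPre

/-!
# PercRepro — the cell `(a, k) = (3, 2)` at `|E ∖ G| = 3`, `q = 4`: the far sets with `S ∖ x ∈ U_G` close (night-2, gen 13)

The assembly of `Night2LocalD3ThreeTwoC/Trace/D/Pre.lean` (`proofs/NIGHT-2-dq3.md` §5.5): at a far set `S` with `coloops S = K ∪ {x}`,
non-coloops `T = {w₁, w₂, w₃}` and `S ∖ x ∈ U_G`, write `r' = req(S ∖ x)`, `rᵢ = req(cand wᵢ)` (or `0` for a non-member),
`aᵢ = rᵢ/(|G ∖ cl(cand wᵢ)| − 1)` (or `0` outside `ex2`), `Lᵢ = r' + Σ_{j ≠ i} rⱼ ≥ L₁(S ∖ wᵢ)`, `λ(L) = (L − 2/5)⁺/L`.  Then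

* `load₂(S) ≤ Σᵢ aᵢ (λ(Lⱼ) + λ(Lₖ))` and `cap₂(S) ≥ 2/5 − r'`;
* every member candidate is thin (`rᵢ ≤ 1/5`, `aᵢ ≤ 1/10`); a candidate with `|G ∖ cl(cand wᵢ)| ≥ 4` has `rᵢ ≤ 6/35`, `aᵢ ≤ 2/35`;
* the trace count gives one such candidate always, and two of them when `|G ∖ cl(S ∖ x)| = 2` (the only case with `r' > 1/5`,
  where `r' = 6/25`);
* the arithmetic (`three_two_arith`, for any nonnegative monotone `λ`; the worst cases `(3, 4, 4)` at `r' = 6/25`: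
  `5521/38199 ≤ 4/25`, and `(3, 3, 4)` at `r' = 1/5`: `169/1050 ≤ 1/5`) closes the column:
  **`load2_le_cap2_three_two_of_erase_mem_Uq`**.

With `load2_le_cap2_three_two_of_not_erase_mem_Uq` this is the whole cell `(3, 2)`: **`load2_le_cap2_three_two`**.
-/

open scoped Matroid

namespace PercRepro.Shadow

open Finset PerFlat ThmH

variable {α : Type*} [DecidableEq α] {M : Matroid α} [M.Finite]

/-! ## The arithmetic -/

omit [DecidableEq α] [M.Finite] in
/-- **The core bound**: monotonicity of every term reduces the column inequality to the evaluation at the type bounds. -/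
theorem three_two_arith (lam : ℚ → ℚ) (hlam0 : ∀ L, 0 ≤ lam L) (hlam : ∀ {L L' : ℚ}, L ≤ L' → lam L ≤ lam L')
    (r' r₁ r₂ r₃ a₁ a₂ a₃ L₁ L₂ L₃ c' c₁ c₂ c₃ b₁ b₂ b₃ : ℚ)
    (ha10 : 0 ≤ a₁) (ha20 : 0 ≤ a₂) (ha30 : 0 ≤ a₃)
    (hL1 : L₁ ≤ r' + r₂ + r₃) (hL2 : L₂ ≤ r' + r₁ + r₃) (hL3 : L₃ ≤ r' + r₁ + r₂)
    (hc' : r' ≤ c') (hc1 : r₁ ≤ c₁) (hc2 : r₂ ≤ c₂) (hc3 : r₃ ≤ c₃) (hb1 : a₁ ≤ b₁) (hb2 : a₂ ≤ b₂) (hb3 : a₃ ≤ b₃)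
    (hfin : b₁ * lam (c' + c₁ + c₃) + b₁ * lam (c' + c₁ + c₂) + b₂ * lam (c' + c₂ + c₃) + b₂ * lam (c' + c₁ + c₂) +
      b₃ * lam (c' + c₂ + c₃) + b₃ * lam (c' + c₁ + c₃) ≤ 2 / 5 - c') :
    a₁ * (lam L₂ + lam L₃) + a₂ * (lam L₁ + lam L₃) + a₃ * (lam L₁ + lam L₂) ≤ 2 / 5 - r' := by
  have l1 : lam L₁ ≤ lam (c' + c₂ + c₃) := hlam (by linarith)
  have l2 : lam L₂ ≤ lam (c' + c₁ + c₃) := hlam (by linarith)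
  have l3 : lam L₃ ≤ lam (c' + c₁ + c₂) := hlam (by linarith)
  have p12 : a₁ * lam L₂ ≤ b₁ * lam (c' + c₁ + c₃) := mul_le_mul hb1 l2 (hlam0 _) (by linarith)
  have p13 : a₁ * lam L₃ ≤ b₁ * lam (c' + c₁ + c₂) := mul_le_mul hb1 l3 (hlam0 _) (by linarith)
  have p21 : a₂ * lam L₁ ≤ b₂ * lam (c' + c₂ + c₃) := mul_le_mul hb2 l1 (hlam0 _) (by linarith)
  have p23 : a₂ * lam L₃ ≤ b₂ * lam (c' + c₁ + c₂) := mul_le_mul hb2 l3 (hlam0 _) (by linarith)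
  have p31 : a₃ * lam L₁ ≤ b₃ * lam (c' + c₂ + c₃) := mul_le_mul hb3 l1 (hlam0 _) (by linarith)
  have p32 : a₃ * lam L₂ ≤ b₃ * lam (c' + c₁ + c₃) := mul_le_mul hb3 l2 (hlam0 _) (by linarith)
  have hexp : a₁ * (lam L₂ + lam L₃) + a₂ * (lam L₁ + lam L₃) + a₃ * (lam L₁ + lam L₂) =
      a₁ * lam L₂ + a₁ * lam L₃ + a₂ * lam L₁ + a₂ * lam L₃ + a₃ * lam L₁ + a₃ * lam L₂ := by ring
  rw [hexp]
  linarith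

/-! ## The candidate bounds -/

section Assembly

variable {G S : Finset α}

omit [DecidableEq α] in
/-- `cl X ⊆ G` for `X ⊆ G` and `G` a flat. -/
theorem clF_subset_of_subset_flatsQ {q : ℕ} (hG : G ∈ flatsQ M q) {X : Finset α} (hX : X ⊆ G) : clF M X ⊆ G :=
  (clF_mono hX).trans (clF_subset_self_of_mem_flatsQ hG)

open scoped Classical in
/-- The layer-2 share of a candidate is nonnegative. -/
theorem cand_share_nonneg {w : α} :
    0 ≤ (if insert w (coloops M S) ∈ ex2 M 4 G S then
      req M 4 (insert w (coloops M S)) / (((G \ clF M (insert w (coloops M S))).card : ℚ) - 1) else 0) := by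
  split_ifs with h
  · obtain ⟨-, -, -, hsub, hcard⟩ := mem_ex2_unpack h
    have hm : 2 ≤ (G \ clF M (insert w (coloops M S))).card := hcard ▸ Finset.card_le_card hsub
    have : (2 : ℚ) ≤ ((G \ clF M (insert w (coloops M S))).card : ℚ) := by exact_mod_cast hm
    exact div_nonneg (req_nonneg 4 _) (by linarith)
  · exact le_refl _

open scoped Classical in
/-- **Type 3**: with `S ∖ x ∈ U_G` every member candidate is thin, so its request is `≤ 1/5` and its share `≤ 1/10`. -/
theorem cand_type_three (hG : G ∈ flatsQ M (4 + 1)) (hd : (gr M \ G).card = 3) (hk : kColoops M G = 2)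
    (hS : S ∈ shadowAt M (4 + 2) 4 (Uq M (4 + 2) 4) G) (hS6 : S.card = 6) (hT : (nonColoops M S).card = 3) {x : α}
    (hxK : x ∉ G.filter (fun y => y ∉ clF M (G.erase y)))
    (hcol : coloops M S = insert x (G.filter (fun y => y ∉ clF M (G.erase y))))
    (hxU : S.erase x ∈ Uq M (4 + 2) 4) {w : α} (hw : w ∈ nonColoops M S) :
    (if insert w (coloops M S) ∈ membersIn M (Uq M (4 + 2) 4) G then req M 4 (insert w (coloops M S)) else 0) ≤ 1 / 5 ∧
    (if insert w (coloops M S) ∈ ex2 M 4 G S then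
      req M 4 (insert w (coloops M S)) / (((G \ clF M (insert w (coloops M S))).card : ℚ) - 1) else 0) ≤ 1 / 10 := by
  have hreq : insert w (coloops M S) ∈ membersIn M (Uq M (4 + 2) 4) G → req M 4 (insert w (coloops M S)) ≤ 1 / 5 := by
    intro hm
    have h3 := three_le_card_sdiff_clF_cand hG hd hk hS hS6 hT hxK hcol hxU hw hm
    have := req_le_of_le_card hG hd (mem_membersIn.1 hm).2 h3
    norm_num at this
    exact this
  constructor
  · split_ifs with h
    · exact hreq h
    · norm_num
  · split_ifs with h
    · have hm := (mem_ex2_unpack h).1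
      obtain ⟨-, -, -, hsub, hcard⟩ := mem_ex2_unpack h
      have h3 := three_le_card_sdiff_clF_cand hG hd hk hS hS6 hT hxK hcol hxU hw hm
      have hden : (2 : ℚ) ≤ ((G \ clF M (insert w (coloops M S))).card : ℚ) - 1 := by
        have : (3 : ℚ) ≤ ((G \ clF M (insert w (coloops M S))).card : ℚ) := by exact_mod_cast h3
        linarith
      calc req M 4 (insert w (coloops M S)) / (((G \ clF M (insert w (coloops M S))).card : ℚ) - 1)
          ≤ (1 / 5) / 2 := div_le_div₀ (by norm_num) (hreq hm) (by norm_num) hden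
        _ = 1 / 10 := by norm_num
    · norm_num

open scoped Classical in
/-- **Type 4**: a candidate with `|G ∖ cl(cand w)| ≥ 4` has request `≤ 6/35` and share `≤ 2/35`. -/
theorem cand_type_four (hG : G ∈ flatsQ M (4 + 1)) (hd : (gr M \ G).card = 3) {w : α}
    (hm4 : 4 ≤ (G \ clF M (insert w (coloops M S))).card) :
    (if insert w (coloops M S) ∈ membersIn M (Uq M (4 + 2) 4) G then req M 4 (insert w (coloops M S)) else 0) ≤ 6 / 35 ∧
    (if insert w (coloops M S) ∈ ex2 M 4 G S then
      req M 4 (insert w (coloops M S)) / (((G \ clF M (insert w (coloops M S))).card : ℚ) - 1) else 0) ≤ 2 / 35 := by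
  have hreq : insert w (coloops M S) ∈ membersIn M (Uq M (4 + 2) 4) G → req M 4 (insert w (coloops M S)) ≤ 6 / 35 := by
    intro hm
    have := req_le_of_le_card hG hd (mem_membersIn.1 hm).2 hm4
    norm_num at this
    exact this
  constructor
  · split_ifs with h
    · exact hreq h
    · norm_num
  · split_ifs with h
    · have hm := (mem_ex2_unpack h).1
      have hden : (3 : ℚ) ≤ ((G \ clF M (insert w (coloops M S))).card : ℚ) - 1 := by
        have : (4 : ℚ) ≤ ((G \ clF M (insert w (coloops M S))).card : ℚ) := by exact_mod_cast hm4
        linarith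
      calc req M 4 (insert w (coloops M S)) / (((G \ clF M (insert w (coloops M S))).card : ℚ) - 1)
          ≤ (6 / 35) / 3 := div_le_div₀ (by norm_num) (hreq hm) (by norm_num) hden
        _ = 2 / 35 := by norm_num
    · norm_num

open scoped Classical in
/-- The load at `S` is at most the sum of the three candidates' layer-2 weights. -/
theorem load2_le_three_cand (hG : G ∈ flatsQ M (4 + 1)) (hd : (gr M \ G).card = 3)
    (hs : ∀ e ∈ gr M, ∀ f ∈ gr M, e ≠ f → rkN M {e, f} = 2) (hS : S ∈ shadowAt M (4 + 2) 4 (Uq M (4 + 2) 4) G)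
    (ha : (coloops M S).card = 3) {w₁ w₂ w₃ : α} (hT3 : nonColoops M S = {w₁, w₂, w₃}) :
    load2 M 4 G S ≤
      (if insert w₁ (coloops M S) ∈ ex2 M 4 G S then w2 M 4 G (insert w₁ (coloops M S)) S else 0) +
      ((if insert w₂ (coloops M S) ∈ ex2 M 4 G S then w2 M 4 G (insert w₂ (coloops M S)) S else 0) +
      (if insert w₃ (coloops M S) ∈ ex2 M 4 G S then w2 M 4 G (insert w₃ (coloops M S)) S else 0)) := by
  have hcap0 : ∀ S', 0 ≤ capS M 4 G S' := capS_nonneg' hG (by omega)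
  have hnn : ∀ B, 0 ≤ (if B ∈ ex2 M 4 G S then w2 M 4 G B S else 0) := by
    intro B; split_ifs
    · exact w2_nonneg (fun z _ => hcap0 _)
    · exact le_refl _
  set U : Finset (Finset α) :=
    {insert w₁ (coloops M S), insert w₂ (coloops M S), insert w₃ (coloops M S)} with hUdef
  have hsub : ex2 M 4 G S ⊆ U := by
    intro B hB
    obtain ⟨w, hw, rfl⟩ := exists_nonColoop_eq_insert_of_mem_ex2 hs hG hS ha hB
    rw [hT3, Finset.mem_insert, Finset.mem_insert, Finset.mem_singleton] at hw
    rw [hUdef, Finset.mem_insert, Finset.mem_insert, Finset.mem_singleton]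
    rcases hw with rfl | rfl | rfl
    · exact Or.inl rfl
    · exact Or.inr (Or.inl rfl)
    · exact Or.inr (Or.inr rfl)
  have hload : load2 M 4 G S = ∑ B ∈ U, (if B ∈ ex2 M 4 G S then w2 M 4 G B S else 0) := by
    unfold load2
    rw [Finset.sum_ite_mem, Finset.inter_eq_right.2 hsub]
    unfold ex2
    rw [Finset.sum_filter_ne_zero]
  rw [hload, hUdef]
  calc ∑ B ∈ ({insert w₁ (coloops M S), insert w₂ (coloops M S), insert w₃ (coloops M S)} : Finset (Finset α)),
        (if B ∈ ex2 M 4 G S then w2 M 4 G B S else 0)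
      ≤ (if insert w₁ (coloops M S) ∈ ex2 M 4 G S then w2 M 4 G (insert w₁ (coloops M S)) S else 0) +
        ∑ B ∈ ({insert w₂ (coloops M S), insert w₃ (coloops M S)} : Finset (Finset α)),
          (if B ∈ ex2 M 4 G S then w2 M 4 G B S else 0) := sum_insert_le_of_nonneg hnn
    _ ≤ (if insert w₁ (coloops M S) ∈ ex2 M 4 G S then w2 M 4 G (insert w₁ (coloops M S)) S else 0) +
        ((if insert w₂ (coloops M S) ∈ ex2 M 4 G S then w2 M 4 G (insert w₂ (coloops M S)) S else 0) +
        ∑ B ∈ ({insert w₃ (coloops M S)} : Finset (Finset α)), (if B ∈ ex2 M 4 G S then w2 M 4 G B S else 0)) := by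
        linarith [sum_insert_le_of_nonneg (s := ({insert w₃ (coloops M S)} : Finset (Finset α)))
          (a := insert w₂ (coloops M S)) hnn]
    _ = _ := by rw [Finset.sum_singleton]

open scoped Classical in
/-- **THE FAR SETS OF THE CELL `(3, 2)` WITH `S ∖ x ∈ U_G` CLOSE**: `load₂(S) ≤ cap₂(S)`. -/
theorem load2_le_cap2_three_two_of_erase_mem_Uq (hs : ∀ e ∈ gr M, ∀ f ∈ gr M, e ≠ f → rkN M {e, f} = 2)
    (hG : G ∈ flatsQ M (4 + 1)) (hd : (gr M \ G).card = 3) (hk : kColoops M G = 2)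
    (hS : S ∈ shadowAt M (4 + 2) 4 (Uq M (4 + 2) 4) G) (ha : (coloops M S).card = 3) {x : α}
    (hxK : x ∉ G.filter (fun y => y ∉ clF M (G.erase y)))
    (hcol : coloops M S = insert x (G.filter (fun y => y ∉ clF M (G.erase y))))
    (hxU : S.erase x ∈ Uq M (4 + 2) 4) : load2 M 4 G S ≤ cap2 M 4 G S := by
  have hSG : S ⊆ G := subset_of_mem_shadowAt hS
  have hcap0 : ∀ S', 0 ≤ capS M 4 G S' := capS_nonneg' hG (by omega)
  have hcap2 := cap2_ge_of_three_two hG hd hk hS hcol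
  by_cases hex : ex2 M 4 G S = ∅
  · have hzero : load2 M 4 G S = 0 := by
      unfold load2
      apply Finset.sum_eq_zero
      intro B hB
      by_contra hne
      have hmem : B ∈ ex2 M 4 G S := by unfold ex2; exact Finset.mem_filter.2 ⟨hB, hne⟩
      rw [hex] at hmem
      exact Finset.notMem_empty _ hmem
    rw [hzero]
    exact cap2_nonneg (hcap0 S)
  obtain ⟨B₀, hB₀⟩ := Finset.nonempty_iff_ne_empty.2 hex
  have hS6 : S.card = 6 := card_eq_six_of_three hs hG hS ha hB₀
  have hT : (nonColoops M S).card = 3 := by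
    have := Finset.card_sdiff_add_card_eq_card (coloops_subset_self (M := M) S)
    unfold nonColoops; omega
  obtain ⟨w₁, w₂, w₃, h12, h13, h23, hT3⟩ := Finset.card_eq_three.1 hT
  have hw₁ : w₁ ∈ nonColoops M S := by rw [hT3]; exact Finset.mem_insert_self _ _
  have hw₂ : w₂ ∈ nonColoops M S := by rw [hT3]; exact Finset.mem_insert_of_mem (Finset.mem_insert_self _ _)
  have hw₃ : w₃ ∈ nonColoops M S := by
    rw [hT3]; exact Finset.mem_insert_of_mem (Finset.mem_insert_of_mem (Finset.mem_singleton_self _))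
  have hxcol : x ∈ coloops M S := by rw [hcol]; exact Finset.mem_insert_self x _
  -- the permuted descriptions of `T`
  have hT3' : nonColoops M S = {w₂, w₁, w₃} := by rw [hT3, Finset.insert_comm w₁ w₂]
  have hT3'' : nonColoops M S = {w₃, w₁, w₂} := by rw [hT3, Finset.pair_comm w₂ w₃, Finset.insert_comm w₁ w₃]
  -- the quantities
  set r' := req M 4 (S.erase x) with hr'def
  set r₁ := (if insert w₁ (coloops M S) ∈ membersIn M (Uq M (4 + 2) 4) G then req M 4 (insert w₁ (coloops M S)) else 0)
    with hr₁def
  set r₂ := (if insert w₂ (coloops M S) ∈ membersIn M (Uq M (4 + 2) 4) G then req M 4 (insert w₂ (coloops M S)) else 0)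
    with hr₂def
  set r₃ := (if insert w₃ (coloops M S) ∈ membersIn M (Uq M (4 + 2) 4) G then req M 4 (insert w₃ (coloops M S)) else 0)
    with hr₃def
  set a₁ := (if insert w₁ (coloops M S) ∈ ex2 M 4 G S then
    req M 4 (insert w₁ (coloops M S)) / (((G \ clF M (insert w₁ (coloops M S))).card : ℚ) - 1) else 0) with ha₁def
  set a₂ := (if insert w₂ (coloops M S) ∈ ex2 M 4 G S then
    req M 4 (insert w₂ (coloops M S)) / (((G \ clF M (insert w₂ (coloops M S))).card : ℚ) - 1) else 0) with ha₂def
  set a₃ := (if insert w₃ (coloops M S) ∈ ex2 M 4 G S then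
    req M 4 (insert w₃ (coloops M S)) / (((G \ clF M (insert w₃ (coloops M S))).card : ℚ) - 1) else 0) with ha₃def
  have hr₁' : insert w₁ (coloops M S) ∈ membersIn M (Uq M (4 + 2) 4) G → req M 4 (insert w₁ (coloops M S)) ≤ r₁ :=
    fun h => by rw [hr₁def, if_pos h]
  have hr₂' : insert w₂ (coloops M S) ∈ membersIn M (Uq M (4 + 2) 4) G → req M 4 (insert w₂ (coloops M S)) ≤ r₂ :=
    fun h => by rw [hr₂def, if_pos h]
  have hr₃' : insert w₃ (coloops M S) ∈ membersIn M (Uq M (4 + 2) 4) G → req M 4 (insert w₃ (coloops M S)) ≤ r₃ :=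
    fun h => by rw [hr₃def, if_pos h]
  have hr₁0 : 0 ≤ r₁ := by rw [hr₁def]; split_ifs; exact req_nonneg 4 _; exact le_refl _
  have hr₂0 : 0 ≤ r₂ := by rw [hr₂def]; split_ifs; exact req_nonneg 4 _; exact le_refl _
  have hr₃0 : 0 ≤ r₃ := by rw [hr₃def]; split_ifs; exact req_nonneg 4 _; exact le_refl _
  have ha₁0 : 0 ≤ a₁ := cand_share_nonneg
  have ha₂0 : 0 ≤ a₂ := cand_share_nonneg
  have ha₃0 : 0 ≤ a₃ := cand_share_nonneg
  -- the layer-1 requests at the covering sets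
  have hL₁ : L1 M 4 G (S.erase w₁) ≤ r' + r₂ + r₃ :=
    L1_erase_le_of_three hG hd hS hS6 hxK hcol hT3 h12 h13 h23 hr₂' hr₃' hr₂0 hr₃0
  have hL₂ : L1 M 4 G (S.erase w₂) ≤ r' + r₁ + r₃ :=
    L1_erase_le_of_three hG hd hS hS6 hxK hcol hT3' h12.symm h23 h13 hr₁' hr₃' hr₁0 hr₃0
  have hL₃ : L1 M 4 G (S.erase w₃) ≤ r' + r₁ + r₂ :=
    L1_erase_le_of_three hG hd hS hS6 hxK hcol hT3'' h13.symm h23.symm h12 hr₁' hr₂' hr₁0 hr₂0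
  -- the load through the three candidates
  have ht₁ : (if insert w₁ (coloops M S) ∈ ex2 M 4 G S then w2 M 4 G (insert w₁ (coloops M S)) S else 0) ≤
      a₁ * ((if r' + r₁ + r₃ ≤ 2 / 5 then (0 : ℚ) else (r' + r₁ + r₃ - 2 / 5) / (r' + r₁ + r₃)) + (if r' + r₁ + r₂ ≤ 2 / 5 then (0 : ℚ) else (r' + r₁ + r₂ - 2 / 5) / (r' + r₁ + r₂))) := by
    by_cases h : insert w₁ (coloops M S) ∈ ex2 M 4 G S
    · rw [ha₁def, if_pos h, if_pos h]
      exact w2_cand_le hd hk hS hT3 h12 h13 h23 h hL₂ hL₃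
    · rw [ha₁def, if_neg h, if_neg h, zero_mul]
  have ht₂ : (if insert w₂ (coloops M S) ∈ ex2 M 4 G S then w2 M 4 G (insert w₂ (coloops M S)) S else 0) ≤
      a₂ * ((if r' + r₂ + r₃ ≤ 2 / 5 then (0 : ℚ) else (r' + r₂ + r₃ - 2 / 5) / (r' + r₂ + r₃)) + (if r' + r₁ + r₂ ≤ 2 / 5 then (0 : ℚ) else (r' + r₁ + r₂ - 2 / 5) / (r' + r₁ + r₂))) := by
    by_cases h : insert w₂ (coloops M S) ∈ ex2 M 4 G S
    · rw [ha₂def, if_pos h, if_pos h]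
      exact w2_cand_le hd hk hS hT3' h12.symm h23 h13 h hL₁ hL₃
    · rw [ha₂def, if_neg h, if_neg h, zero_mul]
  have ht₃ : (if insert w₃ (coloops M S) ∈ ex2 M 4 G S then w2 M 4 G (insert w₃ (coloops M S)) S else 0) ≤
      a₃ * ((if r' + r₂ + r₃ ≤ 2 / 5 then (0 : ℚ) else (r' + r₂ + r₃ - 2 / 5) / (r' + r₂ + r₃)) + (if r' + r₁ + r₃ ≤ 2 / 5 then (0 : ℚ) else (r' + r₁ + r₃ - 2 / 5) / (r' + r₁ + r₃))) := by
    by_cases h : insert w₃ (coloops M S) ∈ ex2 M 4 G S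
    · rw [ha₃def, if_pos h, if_pos h]
      exact w2_cand_le hd hk hS hT3'' h13.symm h23.symm h12 h hL₁ hL₂
    · rw [ha₃def, if_neg h, if_neg h, zero_mul]
  have hload := load2_le_three_cand hG hd hs hS ha hT3
  -- the type bounds
  have hty₁ := cand_type_three hG hd hk hS hS6 hT hxK hcol hxU hw₁
  have hty₂ := cand_type_three hG hd hk hS hS6 hT hxK hcol hxU hw₂
  have hty₃ := cand_type_three hG hd hk hS hS6 hT hxK hcol hxU hw₃
  -- the trace count
  set m₁ := (G \ clF M (insert w₁ (coloops M S))).card with hm₁def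
  set m₂ := (G \ clF M (insert w₂ (coloops M S))).card with hm₂def
  set m₃ := (G \ clF M (insert w₃ (coloops M S))).card with hm₃def
  set c₁ := ((G \ S) ∩ clF M (insert w₁ (coloops M S))).card with hc₁def
  set c₂ := ((G \ S) ∩ clF M (insert w₂ (coloops M S))).card with hc₂def
  set c₃ := ((G \ S) ∩ clF M (insert w₃ (coloops M S))).card with hc₃def
  have hmc₁ : m₁ + c₁ = 2 + (G \ S).card := card_sdiff_clF_cand hG hS hS6 hT hw₁
  have hmc₂ : m₂ + c₂ = 2 + (G \ S).card := card_sdiff_clF_cand hG hS hS6 hT hw₂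
  have hmc₃ : m₃ + c₃ = 2 + (G \ S).card := card_sdiff_clF_cand hG hS hS6 hT hw₃
  have hsum1 : c₁ + c₂ + c₃ ≤ (G \ S).card := by
    have h := sum_card_trace_le_card hs hG hk hS hS6 hT hxK hcol
    rw [hT3, Finset.sum_insert, Finset.sum_insert, Finset.sum_singleton] at h
    · omega
    · rw [Finset.mem_singleton]; exact h23
    · rw [Finset.mem_insert, Finset.mem_singleton]; rintro (h | h); exact h12 h; exact h13 h
  have hsum2 : c₁ + c₂ + c₃ ≤ ((G \ S) \ clF M (S.erase x)).card := by
    have h := sum_card_trace_le hs hG hk hS hS6 hT hxK hcol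
    rw [hT3, Finset.sum_insert, Finset.sum_insert, Finset.sum_singleton] at h
    · omega
    · rw [Finset.mem_singleton]; exact h23
    · rw [Finset.mem_insert, Finset.mem_singleton]; rintro (h | h); exact h12 h; exact h13 h
  have hp2 : 2 ≤ (G \ S).card := two_le_card_sdiff_of_erase_mem_Uq hd hxU
  have hm'eq : (G \ clF M (S.erase x)).card = 1 + ((G \ S) \ clF M (S.erase x)).card :=
    card_sdiff_clF_erase hG hS hxcol
  have hm'2 : 2 ≤ (G \ clF M (S.erase x)).card := two_le_card_sdiff_clF_erase hS hxK hxcol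
  have hr'le : r' ≤ (6 / 5) / (((G \ clF M (S.erase x)).card : ℚ) + 3) :=
    req_le_of_le_card hG hd (clF_subset_of_subset_flatsQ hG ((Finset.erase_subset x S).trans hSG)) (le_refl _)
  have hmain : a₁ * ((if r' + r₁ + r₃ ≤ 2 / 5 then (0 : ℚ) else (r' + r₁ + r₃ - 2 / 5) / (r' + r₁ + r₃)) + (if r' + r₁ + r₂ ≤ 2 / 5 then (0 : ℚ) else (r' + r₁ + r₂ - 2 / 5) / (r' + r₁ + r₂))) + a₂ * ((if r' + r₂ + r₃ ≤ 2 / 5 then (0 : ℚ) else (r' + r₂ + r₃ - 2 / 5) / (r' + r₂ + r₃)) + (if r' + r₁ + r₂ ≤ 2 / 5 then (0 : ℚ) else (r' + r₁ + r₂ - 2 / 5) / (r' + r₁ + r₂))) +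
      a₃ * ((if r' + r₂ + r₃ ≤ 2 / 5 then (0 : ℚ) else (r' + r₂ + r₃ - 2 / 5) / (r' + r₂ + r₃)) + (if r' + r₁ + r₃ ≤ 2 / 5 then (0 : ℚ) else (r' + r₁ + r₃ - 2 / 5) / (r' + r₁ + r₃))) ≤ 2 / 5 - r' := by
    by_cases h3 : 3 ≤ (G \ clF M (S.erase x)).card
    · -- `r' ≤ 1/5`, one candidate of type `4`
      have hr'5 : r' ≤ 1 / 5 := by
        refine hr'le.trans ?_
        have : (6 : ℚ) ≤ ((G \ clF M (S.erase x)).card : ℚ) + 3 := by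
          have : (3 : ℚ) ≤ ((G \ clF M (S.erase x)).card : ℚ) := by exact_mod_cast h3
          linarith
        calc (6 / 5 : ℚ) / (((G \ clF M (S.erase x)).card : ℚ) + 3) ≤ (6 / 5) / 6 :=
              div_le_div_of_nonneg_left (by norm_num) (by norm_num) this
          _ = 1 / 5 := by norm_num
      have hF1 : 4 ≤ m₁ ∨ 4 ≤ m₂ ∨ 4 ≤ m₃ := by omega
      rcases hF1 with h4 | h4 | h4
      · have hty := cand_type_four hG hd h4
        exact three_two_arith (fun L : ℚ => if L ≤ 2 / 5 then (0 : ℚ) else (L - 2 / 5) / L) lossFrac_nonneg (fun h => lossFrac_mono h) r' r₁ r₂ r₃ a₁ a₂ a₃ _ _ _ (1 / 5) (6 / 35) (1 / 5) (1 / 5) (2 / 35) (1 / 10) (1 / 10)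
          ha₁0 ha₂0 ha₃0 (le_refl _) (le_refl _) (le_refl _) hr'5 hty.1 hty₂.1 hty₃.1 hty.2 hty₂.2 hty₃.2
          (by norm_num)
      · have hty := cand_type_four hG hd h4
        exact three_two_arith (fun L : ℚ => if L ≤ 2 / 5 then (0 : ℚ) else (L - 2 / 5) / L) lossFrac_nonneg (fun h => lossFrac_mono h) r' r₁ r₂ r₃ a₁ a₂ a₃ _ _ _ (1 / 5) (1 / 5) (6 / 35) (1 / 5) (1 / 10) (2 / 35) (1 / 10)
          ha₁0 ha₂0 ha₃0 (le_refl _) (le_refl _) (le_refl _) hr'5 hty₁.1 hty.1 hty₃.1 hty₁.2 hty.2 hty₃.2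
          (by norm_num)
      · have hty := cand_type_four hG hd h4
        exact three_two_arith (fun L : ℚ => if L ≤ 2 / 5 then (0 : ℚ) else (L - 2 / 5) / L) lossFrac_nonneg (fun h => lossFrac_mono h) r' r₁ r₂ r₃ a₁ a₂ a₃ _ _ _ (1 / 5) (1 / 5) (1 / 5) (6 / 35) (1 / 10) (1 / 10) (2 / 35)
          ha₁0 ha₂0 ha₃0 (le_refl _) (le_refl _) (le_refl _) hr'5 hty₁.1 hty₂.1 hty.1 hty₁.2 hty₂.2 hty.2
          (by norm_num)
    · -- `|G ∖ cl(S ∖ x)| = 2`: `r' ≤ 6/25`, two candidates of type `4`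
      have hr'6 : r' ≤ 6 / 25 := by
        refine hr'le.trans ?_
        have : (5 : ℚ) ≤ ((G \ clF M (S.erase x)).card : ℚ) + 3 := by
          have : (2 : ℚ) ≤ ((G \ clF M (S.erase x)).card : ℚ) := by exact_mod_cast hm'2
          linarith
        calc (6 / 5 : ℚ) / (((G \ clF M (S.erase x)).card : ℚ) + 3) ≤ (6 / 5) / 5 :=
              div_le_div_of_nonneg_left (by norm_num) (by norm_num) this
          _ = 6 / 25 := by norm_num
      have hF2 : (4 ≤ m₁ ∧ 4 ≤ m₂) ∨ (4 ≤ m₁ ∧ 4 ≤ m₃) ∨ (4 ≤ m₂ ∧ 4 ≤ m₃) := by omega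
      rcases hF2 with ⟨h4, h4'⟩ | ⟨h4, h4'⟩ | ⟨h4, h4'⟩
      · have hty := cand_type_four hG hd h4
        have hty' := cand_type_four hG hd h4'
        exact three_two_arith (fun L : ℚ => if L ≤ 2 / 5 then (0 : ℚ) else (L - 2 / 5) / L) lossFrac_nonneg (fun h => lossFrac_mono h) r' r₁ r₂ r₃ a₁ a₂ a₃ _ _ _ (6 / 25) (6 / 35) (6 / 35) (1 / 5) (2 / 35) (2 / 35) (1 / 10)
          ha₁0 ha₂0 ha₃0 (le_refl _) (le_refl _) (le_refl _) hr'6 hty.1 hty'.1 hty₃.1 hty.2 hty'.2 hty₃.2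
          (by norm_num)
      · have hty := cand_type_four hG hd h4
        have hty' := cand_type_four hG hd h4'
        exact three_two_arith (fun L : ℚ => if L ≤ 2 / 5 then (0 : ℚ) else (L - 2 / 5) / L) lossFrac_nonneg (fun h => lossFrac_mono h) r' r₁ r₂ r₃ a₁ a₂ a₃ _ _ _ (6 / 25) (6 / 35) (1 / 5) (6 / 35) (2 / 35) (1 / 10) (2 / 35)
          ha₁0 ha₂0 ha₃0 (le_refl _) (le_refl _) (le_refl _) hr'6 hty.1 hty₂.1 hty'.1 hty.2 hty₂.2 hty'.2
          (by norm_num)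
      · have hty := cand_type_four hG hd h4
        have hty' := cand_type_four hG hd h4'
        exact three_two_arith (fun L : ℚ => if L ≤ 2 / 5 then (0 : ℚ) else (L - 2 / 5) / L) lossFrac_nonneg (fun h => lossFrac_mono h) r' r₁ r₂ r₃ a₁ a₂ a₃ _ _ _ (6 / 25) (1 / 5) (6 / 35) (6 / 35) (1 / 10) (2 / 35) (2 / 35)
          ha₁0 ha₂0 ha₃0 (le_refl _) (le_refl _) (le_refl _) hr'6 hty₁.1 hty.1 hty'.1 hty₁.2 hty.2 hty'.2
          (by norm_num)
  linarith

open scoped Classical in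
/-- **THE CELL `(a, k) = (3, 2)` AT `|E ∖ G| = 3`, `q = 4`**: every far set with three coloops satisfies `load₂(S) ≤ cap₂(S)`. -/
theorem load2_le_cap2_three_two (hs : ∀ e ∈ gr M, ∀ f ∈ gr M, e ≠ f → rkN M {e, f} = 2)
    (hG : G ∈ flatsQ M (4 + 1)) (hd : (gr M \ G).card = 3) (hk : kColoops M G = 2)
    (hS : S ∈ shadowAt M (4 + 2) 4 (Uq M (4 + 2) 4) G) (ha : (coloops M S).card = 3) :
    load2 M 4 G S ≤ cap2 M 4 G S := by
  obtain ⟨x, hxK, hcol⟩ := exists_coloops_eq_insert hS hk ha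
  by_cases hxU : S.erase x ∈ Uq M (4 + 2) 4
  · exact load2_le_cap2_three_two_of_erase_mem_Uq hs hG hd hk hS ha hxK hcol hxU
  · exact load2_le_cap2_three_two_of_not_erase_mem_Uq hs hG hd hk hS ha hcol hxU

end Assembly

end PercRepro.Shadow
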